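import Literature.Topology.FourManifolds.EmbeddedSurfaceNormalPlane
import Literature.Topology.FourManifolds.NormalRetraction

/-!
# The tautological normal section is nonzero near the surface, for a Whitney embedding proper
# near the surface
(registered helper `helper_wVecNeZeroOfProper` of the stub `stub_normalWitnessTransfer`, line
`cross-cap-laurent`, crux `GromovRecognitionRelEnd`, item stmt-SmoothPoincare4-11009)

Setting: `D : CodimTwoData k X S ℝᵐ` (`EmbeddedSurfaceNormalPlane.lean`): a smooth injective map
`e : X → ℝᵐ` with injective differential of a (not necessarily compact) `(k+2)`-manifold `X`, a
compact embedded `k`-manifold `b : S → X`, `f = e ∘ b`, `img = f(S)`, a tube radius `ε` of `f`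
and the tautological normal section `wVec ε`.  Claim: if `e` is proper near the surface, i.e. the
set `{q | dist (e q, img) ≤ η}` is compact for some `η > 0`, then there is `0 < δ₀ ≤ ε` with
`wVec ε (e q) ≠ 0` whenever `0 < dist (e q, img) < δ₀`.

This is the tree's `CodimTwoData.exists_radius_wVec_ne_zero` with compactness of `X` replaced by
properness of `e` near the surface.  Proof.  (1) A *local normal radius of `e` along the
surface* (`exists_local_normalRadius`): some `εX > 0` such that a normal vector `v ⊥ T_{b x}`,
`‖v‖ < εX`, with endpoint `e (b x) + v = e q` on `e(X)` forces `b x = q` — the argument of the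
tree's `exists_isNormalRadius` (M. W. Hirsch, *Differential Topology* (1976), Ch. 2 §1 Ex. 7 /
Ch. 4 §5 Thm. 5.1: local uniqueness of feet of short normals, `exists_local_uniqueness`, spread
by `IsCompact.eventually_forall_of_forall_eventually`) run over the compact set
`S × {q | dist (e q, img) ≤ η}` instead of `X × X`; points `q` farther than `η` from the surface
are excluded once `εX ≤ η`.  (2) The proof of the tree's `wVec_apply_e_ne_zero` (R. C. Kirby,
*The Topology of 4-Manifolds* (1989), Ch. VIII, proof of Thm. 2, p. 45: the section is nonzero
off the surface) with the local property in place of a global normal radius: if `wVec ε (e q) = 0`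
then `v = e q - f x` (`x` the nearest point) is normal to `e(X)` at `b x`, of length
`dist (e q, img) < εX`, with endpoint `e q`, whence `b x = q` and `v = 0`, contradicting
`dist (e q, img) > 0`.  Output `δ₀ = min ε εX`.
No new definitions.
-/

noncomputable section

open scoped Manifold ContDiff Topology
open Set Function Filter Metric Literature.Topology.FourManifolds

-- the prescribed namespace `Summit.<P>.<Sub>.…` duplicates `SmoothPoincare4` (P = Sub)
set_option linter.dupNamespace false

namespace Summit.SmoothPoincare4.SmoothPoincare4.Theorems.GromovRecognitionRelEnd.CrossCapLaurent

namespace HelperWVecNeZeroOfProper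

variable {k : ℕ} {X : Type*} [TopologicalSpace X] [ChartedSpace (EuclideanSpace ℝ (Fin (k + 2))) X]
  [IsManifold (𝓡 (k + 2)) ∞ X]
  {S : Type*} [TopologicalSpace S] [ChartedSpace (EuclideanSpace ℝ (Fin k)) S] [IsManifold (𝓡 k) ∞ S]
  {V : Type*} [NormedAddCommGroup V] [InnerProductSpace ℝ V] [FiniteDimensional ℝ V]

/-- **Local normal radius of `e` along the surface.** If `{q | dist (e q, f S) ≤ η}` is compact
for some `η > 0`, there is `0 < εX ≤ η` such that for every foot `b x` on the surface, every
normal vector `v ⊥ T_{b x}` with `‖v‖ < εX` whose endpoint `e (b x) + v = e q` lies on `e(X)`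
has `b x = q` (local uniqueness of feet of short normals near each point `b x`, injectivity of
`e` away from them, spread over the compact set `S × {q | dist (e q, f S) ≤ η}`). [folklore] -/
theorem exists_local_normalRadius [CompactSpace S] (D : CodimTwoData k X S V) {η : ℝ}
    (hη : 0 < η) (hK : IsCompact {q : X | infDist (D.e q) D.img ≤ η}) :
    ∃ εX : ℝ, 0 < εX ∧ εX ≤ η ∧ ∀ (x : S) (q : X) (v : V),
      v ∈ normalSpace (𝓡 (k + 2)) D.e (D.b x) → ‖v‖ < εX → D.e (D.b x) + v = D.e q → D.b x = q := by
  let P : V → S × X → Prop := fun v xq => v ∈ normalSpace (𝓡 (k + 2)) D.e (D.b xq.1) →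
    D.e (D.b xq.1) + v = D.e xq.2 → D.b xq.1 = xq.2
  have hP : ∀ xq ∈ (univ : Set S) ×ˢ {q : X | infDist (D.e q) D.img ≤ η},
      ∀ᶠ z : V × (S × X) in 𝓝 (0, xq), P z.1 z.2 := by
    rintro ⟨x, q⟩ -
    by_cases hxq : D.e (D.b x) = D.e q
    · obtain rfl : D.b x = q := D.heinj hxq
      obtain ⟨O, hO, hxO, δ, hδ, hloc⟩ :=
        exists_local_uniqueness (I := 𝓡 (k + 2)) D.he D.hde (D.b x)
      have hc1 : Continuous fun z : V × (S × X) => D.b z.2.1 := by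
        have := D.hb.continuous
        fun_prop
      have hc2 : Continuous fun z : V × (S × X) => z.2.2 := by fun_prop
      have hc3 : Continuous fun z : V × (S × X) => z.1 := by fun_prop
      have h1 : ∀ᶠ z : V × (S × X) in 𝓝 (0, (x, D.b x)), D.b z.2.1 ∈ O :=
        hc1.continuousAt.preimage_mem_nhds (hO.mem_nhds hxO)
      have h2 : ∀ᶠ z : V × (S × X) in 𝓝 (0, (x, D.b x)), z.2.2 ∈ O :=
        hc2.continuousAt.preimage_mem_nhds (hO.mem_nhds hxO)
      have h3 : ∀ᶠ z : V × (S × X) in 𝓝 (0, (x, D.b x)), z.1 ∈ ball (0 : V) δ :=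
        hc3.continuousAt.preimage_mem_nhds (ball_mem_nhds _ hδ)
      filter_upwards [h1, h2, h3] with z hz1 hz2 hz3 hv heq
      have heq' : D.e (D.b z.2.1) + z.1 = D.e z.2.2 + 0 := by rwa [add_zero]
      exact hloc hz1 hz2 hv (Submodule.zero_mem _) (mem_ball_zero_iff.1 hz3)
        (by rw [norm_zero]; exact hδ) heq'
    · have hopen : IsOpen {p : V × V | p.1 ≠ p.2} := isClosed_diagonal.isOpen_compl
      have hc : Continuous fun z : V × (S × X) => (D.e (D.b z.2.1) + z.1, D.e z.2.2) := by
        have := D.he.continuous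
        have := D.hb.continuous
        fun_prop
      have h3 : ∀ᶠ z : V × (S × X) in 𝓝 (0, (x, q)), D.e (D.b z.2.1) + z.1 ≠ D.e z.2.2 := by
        refine hc.continuousAt.preimage_mem_nhds (hopen.mem_nhds ?_)
        simpa using hxq
      filter_upwards [h3] with z hz _ heq
      exact absurd heq hz
  have key := (isCompact_univ.prod hK).eventually_forall_of_forall_eventually hP
  obtain ⟨ε₁, hε₁, hball⟩ := Metric.eventually_nhds_iff_ball.1 key
  refine ⟨min ε₁ η, lt_min hε₁ hη, min_le_right _ _, fun x q v hv hvε heq => ?_⟩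
  have hv₁ : v ∈ ball (0 : V) ε₁ := mem_ball_zero_iff.2 (hvε.trans_le (min_le_left _ _))
  -- the endpoint `e q` is `‖v‖ < η`-close to the surface, so `q` lies in the compact set
  have hqK : infDist (D.e q) D.img ≤ η := by
    have h1 : infDist (D.e q) D.img ≤ dist (D.e q) (D.f x) := infDist_le_dist_of_mem ⟨x, rfl⟩
    have h2 : dist (D.e q) (D.f x) = ‖v‖ := by
      rw [dist_eq_norm, ← heq]
      change ‖D.e (D.b x) + v - D.e (D.b x)‖ = ‖v‖
      rw [add_sub_cancel_left]
    have h3 : ‖v‖ < η := hvε.trans_le (min_le_right _ _)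
    linarith
  exact hball v hv₁ (x, q) (mk_mem_prod (mem_univ _) hqK) hv heq

end HelperWVecNeZeroOfProper

/-- **A radius adapted to the tautological section, for a Whitney embedding proper near the
surface.** Let `D : CodimTwoData k X S ℝᵐ`, `ε` a tube radius of `f = e ∘ b`, and suppose
`{q | dist (e q, f S) ≤ η}` is compact for some `η > 0`.  Then there is `0 < δ₀ ≤ ε` with
`wVec ε (e q) ≠ 0` whenever `0 < dist (e q, f S) < δ₀`: with `εX` a local normal radius of `e`
along the surface (`exists_local_normalRadius`) take `δ₀ = min ε εX`; if `wVec ε (e q) = 0` then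
`v = e q - f x` (`x` the nearest point) is normal to `e(X)` at `b x`, `‖v‖ = dist (e q, f S) < εX`
and `e (b x) + v = e q`, so `b x = q` and `v = 0`, contradicting `dist (e q, f S) > 0`.
[cite: Kirby1989, Ch. VIII, proof of Thm. 2, p. 45] -/
theorem helper_wVecNeZeroOfProper : ∀ (k m : ℕ) (X : Type) [TopologicalSpace X] [ChartedSpace (EuclideanSpace ℝ (Fin (k + 2))) X] [IsManifold (𝓡 (k + 2)) ∞ X] (S : Type) [TopologicalSpace S] [ChartedSpace (EuclideanSpace ℝ (Fin k)) S] [IsManifold (𝓡 k) ∞ S] [CompactSpace S] [Nonempty S] (D : Literature.Topology.FourManifolds.CodimTwoData k X S (EuclideanSpace ℝ (Fin m))) (η ε : ℝ), 0 < η → IsCompact {q : X | Metric.infDist (D.e q) D.img ≤ η} → D.IsTubeRadius ε → ∃ δ₀ : ℝ, 0 < δ₀ ∧ δ₀ ≤ ε ∧ ∀ q : X, 0 < Metric.infDist (D.e q) D.img → Metric.infDist (D.e q) D.img < δ₀ → D.wVec ε (D.e q) ≠ 0 := by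
  intro k m X _ _ _ S _ _ _ _ _ D η ε hη hK hε
  obtain ⟨εX, hεX, -, hloc⟩ := HelperWVecNeZeroOfProper.exists_local_normalRadius D hη hK
  refine ⟨min ε εX, lt_min hε.pos hεX, min_le_left _ _, fun q h0 hlt => ?_⟩
  have hzε : infDist (D.e q) D.img < ε := hlt.trans_le (min_le_left _ _)
  have hzX : infDist (D.e q) D.img < εX := hlt.trans_le (min_le_right _ _)
  intro hw
  set x := D.nearPt ε (D.e q) with hx
  set v : EuclideanSpace ℝ (Fin m) := D.e q - D.f x with hv
  have hdist : ‖v‖ = infDist (D.e q) D.img := D.norm_sub_nearPt hε hzε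
  -- the `TX`-component of the normal vector `v` vanishes: `v ∈ N_{b x}`
  have hPX : tangentProj (𝓡 (k + 2)) D.e (D.b x) v = 0 := by
    rw [← D.wVec_eq_tangentProj hε hzε]
    exact hw
  have hvX : v ∈ normalSpace (𝓡 (k + 2)) D.e (D.b x) := tangentProj_apply_eq_zero_iff.1 hPX
  -- local uniqueness of feet of short normals for `e` along the surface: `b x = q`
  have hvn : ‖v‖ < εX := by rwa [hdist]
  have heq : D.e (D.b x) + v = D.e q := by
    rw [hv]
    simp only [CodimTwoData.f, Function.comp_apply]
    abel
  have hbq : D.b x = q := hloc x q v hvX hvn heq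
  -- hence `v = 0`, contradiction
  have hv0 : v = 0 := by
    rw [hv, ← hbq]
    exact sub_self _
  rw [hv0, norm_zero] at hdist
  exact h0.ne' hdist.symm

end Summit.SmoothPoincare4.SmoothPoincare4.Theorems.GromovRecognitionRelEnd.CrossCapLaurent
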